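import Mathlib

/-!
# The index of `A·V` in a group fibred over a valuation: `[G : A V] = [v(G) : v(A)] · [U : (A ∩ U) V]`

The N5 block counts the characters of `E_v^×` trivial on `F_v^× U_E^n` (Lemma N5.L4(iii):
«θ a character of `E_v^×/F_v^×U_E^n`, a group of order `[U_E : U_F U_E^n]`»; Lemma N5.L4(iv-a):
«`E_v^×/H` is finite» for `H = F_v^× U_E^{2t+1}`). Both are instances of one group-theoretic
identity: for a homomorphism `f : G →* H` of a commutative group `G`, subgroups `A` and
`V ≤ ker f`,

  `[G : A ⊔ V] = [f(G) : f(A)] · [ker f : (A ⊓ ker f) ⊔ V]`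

(the exact sequence `1 → U/(U ∩ AV) → G/AV → f(G)/f(A) → 1` with `U ∩ AV = (A ∩ U)V`, the
modular law). Applied to the valuation `v : E^× → Γ` this is
`[E^× : A V] = [v(E^×) : v(A)] · [U_E : (A ∩ U_E) V]`, and for `Γ = ℤᵐ⁰` the first factor is the
index of `v(A)` in `ℤ` — the ramification index when `A = F_v^×`.

* `sup_inf_ker_eq`: the modular-law step `(A ⊔ V) ⊓ ker f = (A ⊓ ker f) ⊔ V`;
* `index_sup_eq_of_le_ker`, `index_sup_eq_of_le_ker_of_surjective`: the identity;
* `ker_unitsMap_val`, `surjective_unitsMap_val`, `index_sup_eq`: the valuation form, `ker = unitGroup`;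
* `index_zpowers_ofAdd`: `[ℤ : aℤ] = |a|` in multiplicative notation;
* `map_unitsMap_eq_zpowers_of_forall_val_eq_exp_pow`: if every element of `A` has valuation
  `exp (-e)^k` for some `k ∈ ℤ` and `exp (-e)` is attained, then `v(A)` is cyclic on `exp (-e)`
  and `[v(E^×) : v(A)] = e`.

Declaration per README §8(d): «uses an L-value-free non-vanishing device: NO».
-/

namespace Summit.Ventures.HodgeRepro2.T5UnitIndexValuation

section Abstract

variable {G H : Type*} [CommGroup G] [Group H]

/-- The modular law for subgroups of a commutative group, in the form used below:
`(A ⊔ V) ⊓ ker f = (A ⊓ ker f) ⊔ V` when `V ≤ ker f`. -/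
theorem sup_inf_ker_eq (f : G →* H) (A V : Subgroup G) (hV : V ≤ f.ker) :
    (A ⊔ V) ⊓ f.ker = (A ⊓ f.ker) ⊔ V := by
  rw [sup_comm A V, sup_inf_assoc_of_le _ hV, sup_comm]

/-- `[G : A ⊔ V] = [f.range : f(A)] · [ker f : (A ⊓ ker f) ⊔ V]` for `V ≤ ker f`. -/
theorem index_sup_eq_of_le_ker (f : G →* H) (A V : Subgroup G) (hV : V ≤ f.ker) :
    (A ⊔ V).index = (A.map f).relIndex f.range * ((A ⊓ f.ker) ⊔ V).relIndex f.ker := by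
  have h1 : (A ⊔ V) ⊔ f.ker = (A.map f).comap f := by
    rw [Subgroup.comap_map_eq, sup_assoc, sup_eq_right.mpr hV]
  have h2 := Subgroup.relIndex_mul_index (le_sup_left : A ⊔ V ≤ (A ⊔ V) ⊔ f.ker)
  rw [← h2, Subgroup.relIndex_sup_left, ← Subgroup.inf_relIndex_right, sup_inf_ker_eq f A V hV,
    h1, Subgroup.index_comap, mul_comm]

/-- The same with `f` surjective: `[G : A ⊔ V] = [H : f(A)] · [ker f : (A ⊓ ker f) ⊔ V]`. -/
theorem index_sup_eq_of_le_ker_of_surjective (f : G →* H) (hf : Function.Surjective f)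
    (A V : Subgroup G) (hV : V ≤ f.ker) :
    (A ⊔ V).index = (A.map f).index * ((A ⊓ f.ker) ⊔ V).relIndex f.ker := by
  rw [index_sup_eq_of_le_ker f A V hV, MonoidHom.range_eq_top.mpr hf, Subgroup.relIndex_top_right]

/-- In particular `A ⊔ V` has finite index as soon as `f(A)` has finite index in `H` and
`(A ⊓ ker f) ⊔ V` has finite index in `ker f`. -/
theorem index_sup_ne_zero_of_le_ker (f : G →* H) (hf : Function.Surjective f) (A V : Subgroup G)
    (hV : V ≤ f.ker) (hA : (A.map f).index ≠ 0) (hU : ((A ⊓ f.ker) ⊔ V).relIndex f.ker ≠ 0) :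
    (A ⊔ V).index ≠ 0 := by
  rw [index_sup_eq_of_le_ker_of_surjective f hf A V hV]
  exact mul_ne_zero hA hU

end Abstract

section MultiplicativeInt

/-- `[ℤ : aℤ] = |a|`, written multiplicatively: the index of `⟨ofAdd a⟩` in `Multiplicative ℤ`. -/
theorem index_zpowers_ofAdd (a : ℤ) :
    (Subgroup.zpowers (Multiplicative.ofAdd a)).index = a.natAbs := by
  have h : Subgroup.toAddSubgroup' (Subgroup.zpowers (Multiplicative.ofAdd a)) =
      AddSubgroup.zmultiples a := by
    ext x
    rw [Subgroup.mem_toAddSubgroup', Subgroup.mem_zpowers_iff, AddSubgroup.mem_zmultiples_iff]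
    constructor
    · rintro ⟨k, hk⟩
      exact ⟨k, Multiplicative.ofAdd.injective (by rw [ofAdd_zsmul, hk])⟩
    · rintro ⟨k, hk⟩
      exact ⟨k, by rw [← ofAdd_zsmul, hk]⟩
  rw [← Int.index_zmultiples a, ← h]
  rfl

end MultiplicativeInt

section Valued

variable {K : Type*} [Field K] {Γ : Type*} [LinearOrderedCommGroupWithZero Γ] (v : Valuation K Γ)

/-- The kernel of the valuation on units is the unit group of the valuation subring. -/
theorem ker_unitsMap_val :
    (Units.map v.toMonoidWithZeroHom.toMonoidHom).ker = v.valuationSubring.unitGroup := by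
  ext x
  rw [MonoidHom.mem_ker, Valuation.mem_unitGroup_iff, ← Units.val_eq_one, Units.coe_map]
  rfl

/-- A surjective valuation is surjective on units. -/
theorem surjective_unitsMap_val (hv : Function.Surjective v) :
    Function.Surjective (Units.map v.toMonoidWithZeroHom.toMonoidHom) := by
  intro γ
  obtain ⟨x, hx⟩ := hv γ
  have hx0 : x ≠ 0 := by
    rintro rfl
    rw [Valuation.map_zero] at hx
    exact γ.ne_zero hx.symm
  refine ⟨Units.mk0 x hx0, Units.ext ?_⟩
  rw [Units.coe_map]
  exact hx

/-- `[K^× : A ⊔ V] = [Γˣ : v(A)] · [U : (A ⊓ U) ⊔ V]` for `V ≤ U := ` the unit group of the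
valuation subring, `v` surjective. -/
theorem index_sup_eq (hv : Function.Surjective v) (A V : Subgroup Kˣ)
    (hV : V ≤ v.valuationSubring.unitGroup) :
    (A ⊔ V).index = (A.map (Units.map v.toMonoidWithZeroHom.toMonoidHom)).index *
      ((A ⊓ v.valuationSubring.unitGroup) ⊔ V).relIndex v.valuationSubring.unitGroup := by
  rw [← ker_unitsMap_val v] at hV ⊢
  exact index_sup_eq_of_le_ker_of_surjective _ (surjective_unitsMap_val v hv) A V hV

end Valued

section IntValued

variable {K : Type*} [Field K] (v : Valuation K (WithZero (Multiplicative ℤ)))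

/-- `Units.map v` followed by `(ℤᵐ⁰)ˣ ≃* Multiplicative ℤ`, evaluated: `v x = exp m` ⟹ the
image of `x` is `ofAdd m`. -/
theorem unitsWithZeroEquiv_unitsMap_eq_ofAdd (x : Kˣ) {m : ℤ} (hx : v x = WithZero.exp m) :
    WithZero.unitsWithZeroEquiv (Units.map v.toMonoidWithZeroHom.toMonoidHom x) =
      Multiplicative.ofAdd m := by
  apply WithZero.coe_injective
  rw [WithZero.coe_unitsWithZeroEquiv_eq_units_val, Units.coe_map]
  exact hx

/-- If every element of `A` has valuation a power of `exp (-e)` and `exp (-e)` itself is the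
valuation of an element of `A`, then the image of `A` in `Multiplicative ℤ` is `⟨ofAdd (-e)⟩`. -/
theorem map_unitsMap_eq_zpowers (A : Subgroup Kˣ) (e : ℤ)
    (hA : ∀ x ∈ A, ∃ k : ℤ, v x = WithZero.exp (-e) ^ k)
    (hx : ∃ x ∈ A, v x = WithZero.exp (-e)) :
    A.map (WithZero.unitsWithZeroEquiv.toMonoidHom.comp
      (Units.map v.toMonoidWithZeroHom.toMonoidHom)) =
      Subgroup.zpowers (Multiplicative.ofAdd (-e)) := by
  apply le_antisymm
  · rintro _ ⟨x, hxA, rfl⟩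
    obtain ⟨k, hk⟩ := hA x hxA
    rw [Subgroup.mem_zpowers_iff]
    refine ⟨k, ?_⟩
    rw [MonoidHom.comp_apply, MulEquiv.coe_toMonoidHom,
      unitsWithZeroEquiv_unitsMap_eq_ofAdd v x (m := k • (-e)) (by rw [hk, WithZero.exp_zsmul]),
      ofAdd_zsmul]
  · obtain ⟨x, hxA, hxv⟩ := hx
    rw [Subgroup.zpowers_eq_closure, Subgroup.closure_le, Set.singleton_subset_iff]
    exact ⟨x, hxA, by
      rw [MonoidHom.comp_apply, MulEquiv.coe_toMonoidHom, unitsWithZeroEquiv_unitsMap_eq_ofAdd v x hxv]⟩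

/-- Under the hypotheses of `map_unitsMap_eq_zpowers`, `[ (ℤᵐ⁰)ˣ : v(A) ] = e` (`e ≥ 0`). -/
theorem index_map_unitsMap_eq (A : Subgroup Kˣ) (e : ℕ)
    (hA : ∀ x ∈ A, ∃ k : ℤ, v x = WithZero.exp (-(e : ℤ)) ^ k)
    (hx : ∃ x ∈ A, v x = WithZero.exp (-(e : ℤ))) :
    (A.map (Units.map v.toMonoidWithZeroHom.toMonoidHom)).index = e := by
  rw [← Subgroup.index_map_equiv _ WithZero.unitsWithZeroEquiv, Subgroup.map_map]
  change (A.map (WithZero.unitsWithZeroEquiv.toMonoidHom.comp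
    (Units.map v.toMonoidWithZeroHom.toMonoidHom))).index = e
  rw [map_unitsMap_eq_zpowers v A (e : ℤ) hA hx, index_zpowers_ofAdd]
  simp

/-- THE COUNT: `[K^× : A ⊔ V] = e · [U : (A ⊓ U) ⊔ V]` when `v(A) = ⟨exp (-e)⟩`, `V ≤ U`, `v`
surjective. -/
theorem index_sup_eq_mul (hv : Function.Surjective v) (A V : Subgroup Kˣ)
    (hV : V ≤ v.valuationSubring.unitGroup) (e : ℕ)
    (hA : ∀ x ∈ A, ∃ k : ℤ, v x = WithZero.exp (-(e : ℤ)) ^ k)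
    (hx : ∃ x ∈ A, v x = WithZero.exp (-(e : ℤ))) :
    (A ⊔ V).index = e * ((A ⊓ v.valuationSubring.unitGroup) ⊔ V).relIndex
      v.valuationSubring.unitGroup := by
  rw [index_sup_eq v hv A V hV, index_map_unitsMap_eq v A e hA hx]

end IntValued

end Summit.Ventures.HodgeRepro2.T5UnitIndexValuation
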